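import Mathlib
import Literature.MathematicalPhysics.QuantumFieldTheory.PlaquetteRandomCluster
import HarnessLib

/-!
# Comparison inequalities for the plaquette random-cluster model: one-plaquette conditional
# probabilities and the Bernoulli sandwich `ψ_{p̂} ≤_st μ_{p,q} ≤_st ψ_p` (Duncan–Schweinhart, CMP 406 (2025), Lemma 32) — PROVED

Fifth file of the transcription of the Fortuin–Kasteleyn-type representation of `q`-state Potts
lattice gauge theory (companions: `PlaquetteRandomCluster` — setting, readings, SCOPE caveat:
`ℤ_q`/Potts gauge theory only, nothing here bears on the Yang–Mills mass gap or on
`BalabanLadder.IR`; in the `ym` ladder only the conditional finite-`𝕋⁴` rung `BalabanLadder.UV` is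
closed by any route —, `PottsGaugeEdwardsSokal`, `PottsGaugeWilsonLoopTopology`,
`PlaquetteRandomClusterGiantCycles`).

Source: P. Duncan, B. Schweinhart, *Topological phases in the plaquette random-cluster model and
Potts lattice gauge theory*, Comm. Math. Phys. **406** (2025), arXiv:2207.08339
[DuncanSchweinhart2025]: §5.5 **Lemma 32** ("`μ_X` is stochastically decreasing in `q ≥ 1` for
fixed `p`; if we fix `p̂ = (p/q)/(1 - p + p/q)` then `μ_{X,p̂,q,i}` is stochastically increasing in
`q ≥ 1`"; proof: "adding an `i`-plaquette can only reduce `b_{i-1}` by one or leave `b_{i-1}`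
unchanged") together with the one-plaquette conditional probabilities, eq. (openprob) in the proof
of Lemma 47 (§6.5): `μ(σ ∈ T ∣ rest) = p` if opening `σ` leaves `b_{i-1}` unchanged and
`= (p/q)/(1 - p + p/q)` if it lowers it by one; and the comparison with Bernoulli plaquette
percolation that these give (the case `q' = 1` of Lemma 32, used in the proof of Theorem 7:
`μ_{p,q} ≤_st ψ_p` and `ψ_{p̂} ≤_st μ_{p,q}`, `ψ_r = μ_{r,1}` Bernoulli plaquette percolation).
We type `i = 2` on the torus `𝕋^d_L`, as in the companion files, and PROVE everything: the
topological input is `dim Z¹(P ∪ σ) ≥ dim Z¹(P) - 1` (a hyperplane section), the probabilistic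
conclusion is Holley's inequality (Mathlib's four-functions `holley`).

## Main statements (all PROVED; no named fact)

* `bettiOne_mono` (`ω ⊆ ω' → b₁(ω') ≤ b₁(ω)`), `bettiOne_le_bettiOne_insert_add_one`
  (`b₁(ω) ≤ b₁(ω ∪ {σ}) + 1`), `bettiOne_le_bettiOne_union_add_card`;
* `weight_insert_mul_le`, `mul_weight_le_weight_insert` — the two one-plaquette weight-ratio
  bounds, i.e. eq. (openprob): `p̂ ≤ μ(σ open ∣ rest) ≤ p` (`hatParam_le_condProbOpen`,
  `condProbOpen_le`);
* `expect_le_expect_bernoulli` (`μ_{p,q}(h) ≤ ψ_p(h)`) and `expect_bernoulli_hat_le_expect`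
  (`ψ_{p̂}(h) ≤ μ_{p,q}(h)`) for increasing `h`, `p ∈ (0,1)`, `q ≥ 1`, where Bernoulli plaquette
  percolation `ψ_r` is the `q = 1` model (`weight F r 1`);
* Lemma 32 in general (§ `QMonotone`): `expect_le_expect_of_le` (`μ_{p,q₂}(h) ≤ μ_{p,q₁}(h)` for
  `1 ≤ q₁ ≤ q₂`: stochastically DEcreasing in `q` at fixed `p`) and
  `expect_le_expect_of_hatParam_eq` (`μ_{p₁,q₁}(h) ≤ μ_{p₂,q₂}(h)` for `1 ≤ q₁ ≤ q₂`,
  `p̂(p₁,q₁) = p̂(p₂,q₂)`: stochastically INcreasing in `q` at fixed `p̂`), with their Holley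
  conditions `weight_mul_weight_le_of_le`, `weight_mul_weight_le_of_hatParam_eq`.
-/

open Finset

namespace Literature.MathematicalPhysics.QuantumFieldTheory

namespace PlaquetteRC

open LatticeForm

variable {d L : ℕ} [NeZero L] (F : Type*) [Field F]

/-! ### Opening one plaquette lowers `b₁` by at most one -/

section Betti

/-- `b₁` is antitone in the set of open plaquettes: `ω ⊆ ω' → b₁(P(ω')) ≤ b₁(P(ω))`.
[cite: DuncanSchweinhart2025, Lemma 32 (proof)] -/
theorem bettiOne_mono {ω ω' : Finset (Plaquette d L)} (h : ω ⊆ ω') : bettiOne F ω' ≤ bettiOne F ω := by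
  have h1 := bettiOne_add_finrank_grad F ω
  have h2 := bettiOne_add_finrank_grad F ω'
  have hle : Module.finrank F (flatCochains (R := F) (M := F) ω') ≤
      Module.finrank F (flatCochains (R := F) (M := F) ω) :=
    Submodule.finrank_mono (flatCochains_antitone h)
  omega

/-- Evaluation of the plaquette field at `σ`, a linear functional on `C¹`. [cite: DuncanSchweinhart2025, §2.4] -/
def evalPlaq (σ : Plaquette d L) : (Site d L → Fin d → F) →ₗ[F] F where
  toFun θ := res (td₁ θ) σ
  map_add' a b := by
    have h := congrArg (fun ω => res ω σ) (td₁_add a b)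
    simpa [res] using h
  map_smul' c θ := by
    have h := congrArg (fun ω => res ω σ) (td₁_smul (R := F) c θ)
    simpa [res] using h

/-- **"Adding a plaquette can only reduce `b_{i-1}` by one or leave it unchanged"**:
`b₁(P(ω)) ≤ b₁(P(ω ∪ {σ})) + 1` (`Z¹(P(ω ∪ σ))` is the kernel of one linear functional on
`Z¹(P(ω))`). [cite: DuncanSchweinhart2025, Lemma 32 (proof)] -/
theorem bettiOne_le_bettiOne_insert_add_one (σ : Plaquette d L)
    (ω : Finset (Plaquette d L)) : bettiOne F ω ≤ bettiOne F (insert σ ω) + 1 := by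
  have h1 := bettiOne_add_finrank_grad F ω
  have h2 := bettiOne_add_finrank_grad F (insert σ ω)
  -- the functional `θ ↦ (δθ)(σ)` restricted to `Z¹(P(ω))`
  set Z := flatCochains (d := d) (L := L) F F ω with hZ
  set f : Z →ₗ[F] F := (evalPlaq F σ).comp Z.subtype with hf
  have hrk := LinearMap.finrank_range_add_finrank_ker f
  have hrange : Module.finrank F (LinearMap.range f) ≤ 1 := by
    calc Module.finrank F (LinearMap.range f) ≤ Module.finrank F F := Submodule.finrank_le _
      _ = 1 := Module.finrank_self F
  -- `ker f` embeds into `Z¹(P(ω ∪ σ))`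
  have hker : (LinearMap.ker f).map Z.subtype ≤ flatCochains (R := F) (M := F) (insert σ ω) := by
    intro θ hθ
    obtain ⟨z, hz, rfl⟩ := Submodule.mem_map.mp hθ
    intro τ hτ
    rcases Finset.mem_insert.mp hτ with rfl | hτ
    · simpa [hf, evalPlaq] using (LinearMap.mem_ker.mp hz)
    · exact z.2 τ hτ
  have hker' : Module.finrank F (LinearMap.ker f) ≤
      Module.finrank F (flatCochains (R := F) (M := F) (insert σ ω)) := by
    rw [← Submodule.finrank_map_subtype_eq Z (LinearMap.ker f)]
    exact Submodule.finrank_mono hker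
  omega

/-- Iterated form: `b₁(P(ω)) ≤ b₁(P(ω ∪ S)) + |S|`. [cite: DuncanSchweinhart2025, Lemma 32 (proof)] -/
theorem bettiOne_le_bettiOne_union_add_card (ω S : Finset (Plaquette d L)) :
    bettiOne F ω ≤ bettiOne F (ω ∪ S) + S.card := by
  induction S using Finset.induction_on with
  | empty => simp
  | insert a S ha ih =>
    rw [Finset.union_insert, Finset.card_insert_of_notMem ha]
    have := bettiOne_le_bettiOne_insert_add_one F a (ω ∪ S)
    omega

end Betti

/-! ### One-plaquette weight ratios: eq. (openprob) -/

section OnePlaquette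

/-- The reduced parameter `p̂ = (p/q)/(1 - p + p/q) = p/(p + q(1-p))`. [cite: DuncanSchweinhart2025, Lemma 32 (p̂)] -/
noncomputable def hatParam (p q : ℝ) : ℝ := p / (p + q * (1 - p))

/-- `p̂ = (p/q)/(1 - p + p/q)` as printed (for `q ≠ 0`). [cite: DuncanSchweinhart2025, Lemma 32 (p̂)] -/
theorem hatParam_eq {p q : ℝ} (hq : q ≠ 0) : hatParam p q = (p / q) / (1 - p + p / q) := by
  have key : p + q * (1 - p) = q * (1 - p + p / q) := by field_simp; ring
  unfold hatParam
  rw [key, div_mul_eq_div_div]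

/-- Upper weight ratio: `w(ξ ∪ σ)(1-p) ≤ p · w(ξ)` for `σ ∉ ξ`, i.e. opening `σ` has conditional
probability at most `p` (equality iff `b₁` is unchanged). [cite: DuncanSchweinhart2025, Lemma 47 (proof, eq. (openprob))] -/
theorem weight_insert_mul_le {p q : ℝ} (hp : p ∈ Set.Icc (0 : ℝ) 1) (hq : 1 ≤ q)
    {σ : Plaquette d L} {ξ : Finset (Plaquette d L)} (hσ : σ ∉ ξ) :
    weight F p q (insert σ ξ) * (1 - p) ≤ p * weight F p q ξ := by
  have hb := bettiOne_mono F (Finset.subset_insert σ ξ)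
  have h1 : 0 ≤ 1 - p := sub_nonneg.mpr hp.2
  have hcard : (insert σ ξ).card = ξ.card + 1 := Finset.card_insert_of_notMem hσ
  have hcardc : ξᶜ.card = (insert σ ξ)ᶜ.card + 1 := by
    have : (insert σ ξ)ᶜ = ξᶜ.erase σ := by
      ext τ; simp [Finset.mem_compl]
    rw [this, Finset.card_erase_of_mem (Finset.mem_compl.mpr hσ)]
    have : 0 < ξᶜ.card := Finset.card_pos.mpr ⟨σ, Finset.mem_compl.mpr hσ⟩
    omega
  unfold weight
  rw [hcard, hcardc]
  calc p ^ (ξ.card + 1) * (1 - p) ^ (insert σ ξ)ᶜ.card * q ^ bettiOne F (insert σ ξ) * (1 - p)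
      = p * (p ^ ξ.card * (1 - p) ^ ((insert σ ξ)ᶜ.card + 1)) * q ^ bettiOne F (insert σ ξ) := by ring
    _ ≤ p * (p ^ ξ.card * (1 - p) ^ ((insert σ ξ)ᶜ.card + 1)) * q ^ bettiOne F ξ := by
        apply mul_le_mul_of_nonneg_left (pow_le_pow_right₀ hq hb)
        exact mul_nonneg hp.1 (mul_nonneg (pow_nonneg hp.1 _) (pow_nonneg h1 _))
    _ = p * (p ^ ξ.card * (1 - p) ^ ((insert σ ξ)ᶜ.card + 1) * q ^ bettiOne F ξ) := by ring

/-- Lower weight ratio: `p · w(ξ) ≤ q(1-p) · w(ξ ∪ σ)` for `σ ∉ ξ`, i.e. opening `σ` has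
conditional probability at least `p̂ = p/(p + q(1-p))` (equality iff opening `σ` lowers `b₁` by one).
[cite: DuncanSchweinhart2025, Lemma 47 (proof, eq. (openprob))] -/
theorem mul_weight_le_weight_insert {p q : ℝ} (hp : p ∈ Set.Icc (0 : ℝ) 1) (hq : 1 ≤ q)
    {σ : Plaquette d L} {ξ : Finset (Plaquette d L)} (hσ : σ ∉ ξ) :
    p * weight F p q ξ ≤ q * (1 - p) * weight F p q (insert σ ξ) := by
  have hb := bettiOne_le_bettiOne_insert_add_one F σ ξ
  have h1 : 0 ≤ 1 - p := sub_nonneg.mpr hp.2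
  have hq0 : 0 ≤ q := zero_le_one.trans hq
  have hcard : (insert σ ξ).card = ξ.card + 1 := Finset.card_insert_of_notMem hσ
  have hcardc : ξᶜ.card = (insert σ ξ)ᶜ.card + 1 := by
    have : (insert σ ξ)ᶜ = ξᶜ.erase σ := by
      ext τ; simp [Finset.mem_compl]
    rw [this, Finset.card_erase_of_mem (Finset.mem_compl.mpr hσ)]
    have : 0 < ξᶜ.card := Finset.card_pos.mpr ⟨σ, Finset.mem_compl.mpr hσ⟩
    omega
  unfold weight
  rw [hcard, hcardc]
  calc p * (p ^ ξ.card * (1 - p) ^ ((insert σ ξ)ᶜ.card + 1) * q ^ bettiOne F ξ)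
      = (1 - p) * (p ^ (ξ.card + 1) * (1 - p) ^ (insert σ ξ)ᶜ.card) * q ^ bettiOne F ξ := by ring
    _ ≤ (1 - p) * (p ^ (ξ.card + 1) * (1 - p) ^ (insert σ ξ)ᶜ.card) *
          q ^ (bettiOne F (insert σ ξ) + 1) := by
        apply mul_le_mul_of_nonneg_left (pow_le_pow_right₀ hq hb)
        exact mul_nonneg h1 (mul_nonneg (pow_nonneg hp.1 _) (pow_nonneg h1 _))
    _ = q * (1 - p) * (p ^ (ξ.card + 1) * (1 - p) ^ (insert σ ξ)ᶜ.card *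
          q ^ bettiOne F (insert σ ξ)) := by ring

/-- The one-plaquette conditional probability `μ(σ open ∣ the other plaquettes agree with ξ)`
(`σ ∉ ξ`): `w(ξ ∪ σ) / (w(ξ ∪ σ) + w(ξ))`. [cite: DuncanSchweinhart2025, Lemma 47 (proof, eq. (openprob))] -/
noncomputable def condProbOpen (p q : ℝ) (σ : Plaquette d L) (ξ : Finset (Plaquette d L)) : ℝ :=
  weight F p q (insert σ ξ) / (weight F p q (insert σ ξ) + weight F p q ξ)

/-- **eq. (openprob), upper half**: `μ(σ open ∣ rest) ≤ p`. [cite: DuncanSchweinhart2025, Lemma 47 (proof, eq. (openprob))] -/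
theorem condProbOpen_le {p q : ℝ} (hp : p ∈ Set.Ioo (0 : ℝ) 1) (hq : 1 ≤ q)
    {σ : Plaquette d L} {ξ : Finset (Plaquette d L)} (hσ : σ ∉ ξ) :
    condProbOpen F p q σ ξ ≤ p := by
  have hp' : p ∈ Set.Icc (0 : ℝ) 1 := ⟨hp.1.le, hp.2.le⟩
  have hq' : 0 < q := zero_lt_one.trans_le hq
  have w1 := weight_pos F hp hq' (insert σ ξ)
  have w0 := weight_pos F hp hq' ξ
  unfold condProbOpen
  rw [div_le_iff₀ (by linarith)]
  have := weight_insert_mul_le F hp' hq hσ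
  nlinarith

/-- **eq. (openprob), lower half**: `p̂ ≤ μ(σ open ∣ rest)`. [cite: DuncanSchweinhart2025, Lemma 47 (proof, eq. (openprob))] -/
theorem hatParam_le_condProbOpen {p q : ℝ} (hp : p ∈ Set.Ioo (0 : ℝ) 1) (hq : 1 ≤ q)
    {σ : Plaquette d L} {ξ : Finset (Plaquette d L)} (hσ : σ ∉ ξ) :
    hatParam p q ≤ condProbOpen F p q σ ξ := by
  have hp' : p ∈ Set.Icc (0 : ℝ) 1 := ⟨hp.1.le, hp.2.le⟩
  have hq' : 0 < q := zero_lt_one.trans_le hq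
  have w1 := weight_pos F hp hq' (insert σ ξ)
  have w0 := weight_pos F hp hq' ξ
  have hden : 0 < p + q * (1 - p) := by nlinarith [hp.1, hp.2]
  unfold condProbOpen hatParam
  rw [div_le_div_iff₀ hden (by linarith)]
  have := mul_weight_le_weight_insert F hp' hq hσ
  nlinarith

end OnePlaquette

/-! ### The Bernoulli sandwich (Lemma 32 with `q' = 1`) -/

section Sandwich

/-- For `q = 1` the weights are the Bernoulli plaquette-percolation weights `r^{|ω|}(1-r)^{|ωᶜ|}`
and sum to `1`. [cite: DuncanSchweinhart2025, §1.1 ("b₀ … generalization of the classical random-cluster model"; q = 1 = plaquette percolation, Conj. 6 ff.)] -/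
theorem partitionFn_one (r : ℝ) : partitionFn (d := d) (L := L) F r 1 = 1 := by
  classical
  unfold partitionFn weight
  simp only [one_pow, mul_one]
  have h := Fintype.sum_pow_mul_eq_add_pow (Plaquette d L) r (1 - r)
  rw [add_sub_cancel, one_pow] at h
  conv_rhs => rw [← h]
  refine Finset.sum_congr rfl fun ω _ => ?_
  rw [Finset.card_compl]

/-- **Holley condition for `μ_{p,q}` versus `ψ_p`**: `w_{p,q}(a) w_{p,1}(b) ≤ w_{p,q}(a ∩ b) w_{p,1}(a ∪ b)`
(`b₁` is antitone). [cite: DuncanSchweinhart2025, Lemma 32 (proof)] -/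
theorem weight_mul_bernoulli_le {p q : ℝ} (hp : p ∈ Set.Icc (0 : ℝ) 1)
    (hq : 1 ≤ q) (a b : Finset (Plaquette d L)) :
    weight F p q a * weight F p 1 b ≤ weight F p q (a ⊓ b) * weight F p 1 (a ⊔ b) := by
  have hcard : a.card + b.card = (a ∩ b).card + (a ∪ b).card := by
    rw [Finset.card_inter_add_card_union]
  have hcardc : aᶜ.card + bᶜ.card = (a ∩ b)ᶜ.card + (a ∪ b)ᶜ.card := by
    rw [Finset.compl_inter, Finset.compl_union, add_comm ((aᶜ ∪ bᶜ).card),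
      Finset.card_inter_add_card_union]
  have hb := bettiOne_mono F (Finset.inter_subset_left (s₁ := a) (s₂ := b))
  have h1 : 0 ≤ 1 - p := sub_nonneg.mpr hp.2
  unfold weight
  simp only [Finset.inf_eq_inter, Finset.sup_eq_union, one_pow, mul_one]
  calc p ^ a.card * (1 - p) ^ aᶜ.card * q ^ bettiOne F a * (p ^ b.card * (1 - p) ^ bᶜ.card)
      = p ^ (a.card + b.card) * (1 - p) ^ (aᶜ.card + bᶜ.card) * q ^ bettiOne F a := by ring
    _ ≤ p ^ (a.card + b.card) * (1 - p) ^ (aᶜ.card + bᶜ.card) * q ^ bettiOne F (a ∩ b) := by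
        apply mul_le_mul_of_nonneg_left (pow_le_pow_right₀ hq hb)
        exact mul_nonneg (pow_nonneg hp.1 _) (pow_nonneg h1 _)
    _ = p ^ (a ∩ b).card * (1 - p) ^ (a ∩ b)ᶜ.card * q ^ bettiOne F (a ∩ b) *
          (p ^ (a ∪ b).card * (1 - p) ^ (a ∪ b)ᶜ.card) := by rw [hcard, hcardc]; ring

/-- **Holley condition for `ψ_{p̂}` versus `μ_{p,q}`**:
`w_{p̂,1}(a) w_{p,q}(b) ≤ w_{p̂,1}(a ∩ b) w_{p,q}(a ∪ b)` (`b₁` drops by at most one per added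
plaquette, and `p̂/(1-p̂) = p/(q(1-p))`). [cite: DuncanSchweinhart2025, Lemma 32 (proof)] -/
theorem bernoulli_hat_mul_weight_le {p q : ℝ}
    (hp : p ∈ Set.Ioo (0 : ℝ) 1) (hq : 1 ≤ q) (a b : Finset (Plaquette d L)) :
    weight F (hatParam p q) 1 a * weight F p q b ≤
      weight F (hatParam p q) 1 (a ⊓ b) * weight F p q (a ⊔ b) := by
  have hq0 : 0 < q := zero_lt_one.trans_le hq
  have h1 : 0 < 1 - p := sub_pos.mpr hp.2
  have hden : 0 < p + q * (1 - p) := by nlinarith [hp.1]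
  -- cardinalities: `k = |a \ b|`
  set k := (a \ b).card with hk
  have hca : a.card = (a ∩ b).card + k := by
    have := Finset.card_sdiff_add_card_inter a b
    omega
  have hcu : (a ∪ b).card = b.card + k := by
    rw [hk, ← Finset.card_union_of_disjoint (Finset.disjoint_sdiff (s := b) (t := a)),
      Finset.union_sdiff_self_eq_union, Finset.union_comm]
  have hcac : (a ∩ b)ᶜ.card = aᶜ.card + k := by
    have := Finset.card_compl (a ∩ b); have := Finset.card_compl a
    have : (a ∩ b).card ≤ a.card := Finset.card_le_card Finset.inter_subset_left
    have : a.card ≤ Fintype.card (Plaquette d L) := Finset.card_le_univ a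
    omega
  have hcbc : bᶜ.card = (a ∪ b)ᶜ.card + k := by
    have := Finset.card_compl (a ∪ b); have := Finset.card_compl b
    have : (a ∪ b).card ≤ Fintype.card (Plaquette d L) := Finset.card_le_univ _
    omega
  -- Betti numbers: `b₁(b) ≤ b₁(a ∪ b) + k`
  have hb : bettiOne F b ≤ bettiOne F (a ∪ b) + k := by
    have := bettiOne_le_bettiOne_union_add_card F b (a \ b)
    rwa [Finset.union_sdiff_self_eq_union, Finset.union_comm] at this
  -- the reduced parameter: `(1 - p̂) p = q · p̂ (1 - p)`
  have hP : hatParam p q ∈ Set.Ioo (0 : ℝ) 1 := by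
    unfold hatParam
    exact ⟨div_pos hp.1 hden, by rw [div_lt_one hden]; nlinarith [hp.2]⟩
  have key : (1 - hatParam p q) * p = q * (hatParam p q * (1 - p)) := by
    unfold hatParam
    field_simp
    ring
  set P := hatParam p q with hPdef
  have hP0 : 0 ≤ P := hP.1.le
  have hQ0 : 0 ≤ 1 - P := sub_nonneg.mpr hP.2.le
  have hqb : q ^ bettiOne F b ≤ q ^ (bettiOne F (a ∪ b) + k) := pow_le_pow_right₀ hq hb
  unfold weight
  simp only [Finset.inf_eq_inter, Finset.sup_eq_union, one_pow, mul_one]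
  rw [hca, hcu, hcac, hcbc]
  have hM : 0 ≤ P ^ (a ∩ b).card * (1 - P) ^ aᶜ.card * p ^ b.card * (1 - p) ^ (a ∪ b)ᶜ.card :=
    mul_nonneg (mul_nonneg (mul_nonneg (pow_nonneg hP0 _) (pow_nonneg hQ0 _)) (pow_nonneg hp.1.le _))
      (pow_nonneg h1.le _)
  have keyk : (1 - P) ^ k * p ^ k = q ^ k * (P ^ k * (1 - p) ^ k) := by
    have := congrArg (fun x : ℝ => x ^ k) key
    simpa only [mul_pow] using this
  calc P ^ ((a ∩ b).card + k) * (1 - P) ^ aᶜ.card *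
        (p ^ b.card * (1 - p) ^ ((a ∪ b)ᶜ.card + k) * q ^ bettiOne F b)
      = (P ^ (a ∩ b).card * (1 - P) ^ aᶜ.card * p ^ b.card * (1 - p) ^ (a ∪ b)ᶜ.card) *
          (P ^ k * (1 - p) ^ k * q ^ bettiOne F b) := by rw [pow_add, pow_add]; ring
    _ ≤ (P ^ (a ∩ b).card * (1 - P) ^ aᶜ.card * p ^ b.card * (1 - p) ^ (a ∪ b)ᶜ.card) *
          (P ^ k * (1 - p) ^ k * q ^ (bettiOne F (a ∪ b) + k)) :=
        mul_le_mul_of_nonneg_left (mul_le_mul_of_nonneg_left hqb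
          (mul_nonneg (pow_nonneg hP0 _) (pow_nonneg h1.le _))) hM
    _ = P ^ (a ∩ b).card * (1 - P) ^ (aᶜ.card + k) *
          (p ^ (b.card + k) * (1 - p) ^ (a ∪ b)ᶜ.card * q ^ bettiOne F (a ∪ b)) := by
        rw [pow_add, pow_add, pow_add]
        linear_combination (-(P ^ (a ∩ b).card * (1 - P) ^ aᶜ.card * p ^ b.card *
          (1 - p) ^ (a ∪ b)ᶜ.card * q ^ bettiOne F (a ∪ b))) * keyk

/-- **Lemma 32 with `q' = 1` (upper comparison), PROVED: `μ_{p,q} ≤_st ψ_p`** — for every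
increasing non-negative `h`, `μ_{X,p,q}(h) ≤ ψ_p(h)` where `ψ_p = μ_{X,p,1}` is Bernoulli plaquette
percolation; `p ∈ (0,1)`, `q ≥ 1`. By Holley's inequality. [cite: DuncanSchweinhart2025, Lemma 32] -/
theorem expect_le_expect_bernoulli {p q : ℝ} (hp : p ∈ Set.Ioo (0 : ℝ) 1) (hq : 1 ≤ q)
    {h : Finset (Plaquette d L) → ℝ} (hh₀ : 0 ≤ h) (hh : Monotone h) :
    expect F p q h ≤ expect F p 1 h := by
  classical
  have hp' : p ∈ Set.Icc (0 : ℝ) 1 := ⟨hp.1.le, hp.2.le⟩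
  have hq' : 0 < q := zero_lt_one.trans_le hq
  have hZ := partitionFn_pos (d := d) (L := L) F hp hq'
  have hZ1 := partitionFn_one (d := d) (L := L) F p
  unfold expect
  have e1 : ∀ ω, prob F p q ω * h ω = h ω * prob F p q ω := fun ω => mul_comm _ _
  have e2 : ∀ ω, prob F p 1 ω * h ω = h ω * prob F p 1 ω := fun ω => mul_comm _ _
  simp_rw [e1, e2]
  refine holley (prob (d := d) (L := L) F p q) (prob (d := d) (L := L) F p 1) h hh₀
    (fun ω => div_nonneg (weight_nonneg F hp' hq'.le ω) hZ.le)
    (fun ω => div_nonneg (weight_nonneg F hp' zero_le_one ω) (by rw [hZ1]; exact zero_le_one))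
    hh ?_ ?_
  · rw [sum_prob_eq_one F hp hq', sum_prob_eq_one F hp zero_lt_one]
  · intro a b
    unfold prob
    rw [hZ1, div_one, div_one, div_mul_eq_mul_div, div_mul_eq_mul_div,
      div_le_div_iff_of_pos_right hZ]
    exact weight_mul_bernoulli_le F hp' hq a b

/-- **Lemma 32 with `q' = 1` (lower comparison), PROVED: `ψ_{p̂} ≤_st μ_{p,q}`** with
`p̂ = (p/q)/(1 - p + p/q)` — for every increasing non-negative `h`, `ψ_{p̂}(h) ≤ μ_{X,p,q}(h)`;
`p ∈ (0,1)`, `q ≥ 1`. By Holley's inequality. [cite: DuncanSchweinhart2025, Lemma 32] -/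
theorem expect_bernoulli_hat_le_expect {p q : ℝ} (hp : p ∈ Set.Ioo (0 : ℝ) 1) (hq : 1 ≤ q)
    {h : Finset (Plaquette d L) → ℝ} (hh₀ : 0 ≤ h) (hh : Monotone h) :
    expect F (hatParam p q) 1 h ≤ expect F p q h := by
  classical
  have hp' : p ∈ Set.Icc (0 : ℝ) 1 := ⟨hp.1.le, hp.2.le⟩
  have hq' : 0 < q := zero_lt_one.trans_le hq
  have hden : 0 < p + q * (1 - p) := by nlinarith [hp.1, hp.2]
  have hph : hatParam p q ∈ Set.Ioo (0 : ℝ) 1 := by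
    unfold hatParam
    constructor
    · exact div_pos hp.1 hden
    · rw [div_lt_one hden]; nlinarith [hp.2]
  have hph' : hatParam p q ∈ Set.Icc (0 : ℝ) 1 := ⟨hph.1.le, hph.2.le⟩
  have hZ := partitionFn_pos (d := d) (L := L) F hp hq'
  have hZ1 := partitionFn_one (d := d) (L := L) F (hatParam p q)
  unfold expect
  have e1 : ∀ ω, prob F p q ω * h ω = h ω * prob F p q ω := fun ω => mul_comm _ _
  have e2 : ∀ ω, prob F (hatParam p q) 1 ω * h ω = h ω * prob F (hatParam p q) 1 ω :=
    fun ω => mul_comm _ _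
  simp_rw [e1, e2]
  refine holley (prob (d := d) (L := L) F (hatParam p q) 1) (prob (d := d) (L := L) F p q) h hh₀
    (fun ω => div_nonneg (weight_nonneg F hph' zero_le_one ω) (by rw [hZ1]; exact zero_le_one))
    (fun ω => div_nonneg (weight_nonneg F hp' hq'.le ω) hZ.le)
    hh ?_ ?_
  · rw [sum_prob_eq_one F hph zero_lt_one, sum_prob_eq_one F hp hq']
  · intro a b
    unfold prob
    rw [hZ1, div_one, div_one]
    simp only [mul_div_assoc']
    rw [div_le_div_iff_of_pos_right hZ]
    exact bernoulli_hat_mul_weight_le F hp hq a b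

end Sandwich

/-! ### Lemma 32 in general: monotonicity in `q` at fixed `p`, and at fixed `p̂` -/

section QMonotone

/-- **Holley condition behind Lemma 32 (fixed `p`)**: for `1 ≤ q₁ ≤ q₂` and `p ∈ [0,1]`,
`w_{p,q₂}(a) · w_{p,q₁}(b) ≤ w_{p,q₂}(a ∩ b) · w_{p,q₁}(a ∪ b)`.  Bookkeeping: with
`b₁(a ∩ b) = b₁(a) + s`, `b₁(b) = b₁(a ∪ b) + t` one has `t ≤ s` (Theorem 16's lattice inequality),
so `q₁^t ≤ q₂^t ≤ q₂^s`. [cite: DuncanSchweinhart2025, Lemma 32 (proof)] -/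
theorem weight_mul_weight_le_of_le {p q₁ q₂ : ℝ} (hp : p ∈ Set.Icc (0 : ℝ) 1) (hq₁ : 1 ≤ q₁)
    (h12 : q₁ ≤ q₂) (a b : Finset (Plaquette d L)) :
    weight F p q₂ a * weight F p q₁ b ≤ weight F p q₂ (a ⊓ b) * weight F p q₁ (a ⊔ b) := by
  classical
  have hq₂ : 1 ≤ q₂ := hq₁.trans h12
  have hq1n : 0 ≤ q₁ := zero_le_one.trans hq₁
  have hq2n : 0 ≤ q₂ := zero_le_one.trans hq₂
  have hcard : a.card + b.card = (a ∩ b).card + (a ∪ b).card := by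
    rw [Finset.card_inter_add_card_union]
  have hcardc : aᶜ.card + bᶜ.card = (a ∩ b)ᶜ.card + (a ∪ b)ᶜ.card := by
    rw [Finset.compl_inter, Finset.compl_union, add_comm ((aᶜ ∪ bᶜ).card),
      Finset.card_inter_add_card_union]
  have hsa : bettiOne F a ≤ bettiOne F (a ∩ b) := bettiOne_mono F Finset.inter_subset_left
  have htb : bettiOne F (a ∪ b) ≤ bettiOne F b := bettiOne_mono F Finset.subset_union_right
  have hmv := bettiOne_union_add_inter F a b
  obtain ⟨s, hs⟩ := Nat.exists_eq_add_of_le hsa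
  obtain ⟨t, ht⟩ := Nat.exists_eq_add_of_le htb
  have hts : t ≤ s := by omega
  have hq : q₁ ^ t ≤ q₂ ^ s :=
    (pow_le_pow_left₀ hq1n h12 t).trans (pow_le_pow_right₀ hq₂ hts)
  have h1 : 0 ≤ 1 - p := sub_nonneg.mpr hp.2
  have hM : 0 ≤ p ^ (a.card + b.card) * (1 - p) ^ (aᶜ.card + bᶜ.card) * q₂ ^ bettiOne F a *
      q₁ ^ bettiOne F (a ∪ b) :=
    mul_nonneg (mul_nonneg (mul_nonneg (pow_nonneg hp.1 _) (pow_nonneg h1 _)) (pow_nonneg hq2n _))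
      (pow_nonneg hq1n _)
  unfold weight
  simp only [Finset.inf_eq_inter, Finset.sup_eq_union]
  rw [hs, ht]
  calc p ^ a.card * (1 - p) ^ aᶜ.card * q₂ ^ bettiOne F a *
        (p ^ b.card * (1 - p) ^ bᶜ.card * q₁ ^ (bettiOne F (a ∪ b) + t))
      = p ^ (a.card + b.card) * (1 - p) ^ (aᶜ.card + bᶜ.card) * q₂ ^ bettiOne F a *
          q₁ ^ bettiOne F (a ∪ b) * q₁ ^ t := by simp only [pow_add]; ring
    _ ≤ p ^ (a.card + b.card) * (1 - p) ^ (aᶜ.card + bᶜ.card) * q₂ ^ bettiOne F a *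
          q₁ ^ bettiOne F (a ∪ b) * q₂ ^ s := mul_le_mul_of_nonneg_left hq hM
    _ = p ^ (a ∩ b).card * (1 - p) ^ (a ∩ b)ᶜ.card * q₂ ^ (bettiOne F a + s) *
          (p ^ (a ∪ b).card * (1 - p) ^ (a ∪ b)ᶜ.card * q₁ ^ bettiOne F (a ∪ b)) := by
        rw [hcard, hcardc]; simp only [pow_add]; ring

/-- **Lemma 32, first half, PROVED: `μ_{X,p,q}` is stochastically decreasing in `q ≥ 1` for fixed
`p`** — for `p ∈ (0,1)`, `1 ≤ q₁ ≤ q₂` and every increasing non-negative `h`,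
`μ_{X,p,q₂}(h) ≤ μ_{X,p,q₁}(h)` (typed for `i = 2` on the torus). By Holley's inequality.
[cite: DuncanSchweinhart2025, Lemma 32] -/
theorem expect_le_expect_of_le {p q₁ q₂ : ℝ} (hp : p ∈ Set.Ioo (0 : ℝ) 1) (hq₁ : 1 ≤ q₁)
    (h12 : q₁ ≤ q₂) {h : Finset (Plaquette d L) → ℝ} (hh₀ : 0 ≤ h) (hh : Monotone h) :
    expect F p q₂ h ≤ expect F p q₁ h := by
  classical
  have hp' : p ∈ Set.Icc (0 : ℝ) 1 := ⟨hp.1.le, hp.2.le⟩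
  have hq1p : 0 < q₁ := zero_lt_one.trans_le hq₁
  have hq2p : 0 < q₂ := hq1p.trans_le h12
  have hZ1 := partitionFn_pos (d := d) (L := L) F hp hq1p
  have hZ2 := partitionFn_pos (d := d) (L := L) F hp hq2p
  unfold expect
  have e1 : ∀ ω, prob F p q₁ ω * h ω = h ω * prob F p q₁ ω := fun ω => mul_comm _ _
  have e2 : ∀ ω, prob F p q₂ ω * h ω = h ω * prob F p q₂ ω := fun ω => mul_comm _ _
  simp_rw [e1, e2]
  refine holley (prob (d := d) (L := L) F p q₂) (prob (d := d) (L := L) F p q₁) h hh₀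
    (fun ω => div_nonneg (weight_nonneg F hp' hq2p.le ω) hZ2.le)
    (fun ω => div_nonneg (weight_nonneg F hp' hq1p.le ω) hZ1.le)
    hh ?_ ?_
  · rw [sum_prob_eq_one F hp hq2p, sum_prob_eq_one F hp hq1p]
  · intro a b
    unfold prob
    rw [div_mul_div_comm, div_mul_div_comm]
    exact div_le_div_of_nonneg_right (weight_mul_weight_le_of_le F hp' hq₁ h12 a b)
      (mul_nonneg hZ2.le hZ1.le)

/-- Fixing `p̂ = (p/q)/(1 - p + p/q)` is fixing the ratio `p/(q(1-p))`: `p̂(p₁,q₁) = p̂(p₂,q₂)` iff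
`p₁ (1 - p₂) q₂ = p₂ (1 - p₁) q₁` (`p_i ∈ (0,1)`, `q_i > 0`). [cite: DuncanSchweinhart2025, Lemma 32 (proof)] -/
theorem hatParam_eq_hatParam_iff {p₁ p₂ q₁ q₂ : ℝ} (hp₁ : p₁ ∈ Set.Ioo (0 : ℝ) 1)
    (hp₂ : p₂ ∈ Set.Ioo (0 : ℝ) 1) (hq₁ : 0 < q₁) (hq₂ : 0 < q₂) :
    hatParam p₁ q₁ = hatParam p₂ q₂ ↔ p₁ * (1 - p₂) * q₂ = p₂ * (1 - p₁) * q₁ := by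
  have hd1 : 0 < p₁ + q₁ * (1 - p₁) := by nlinarith [hp₁.1, hp₁.2]
  have hd2 : 0 < p₂ + q₂ * (1 - p₂) := by nlinarith [hp₂.1, hp₂.2]
  unfold hatParam
  rw [div_eq_div_iff hd1.ne' hd2.ne']
  constructor <;> intro h <;> linarith

/-- **Holley condition behind Lemma 32 (fixed `p̂`)**: for `p₁, p₂ ∈ (0,1)`, `1 ≤ q₁ ≤ q₂` with
`p̂(p₁,q₁) = p̂(p₂,q₂)`, `w_{p₁,q₁}(a) · w_{p₂,q₂}(b) ≤ w_{p₁,q₁}(a ∩ b) · w_{p₂,q₂}(a ∪ b)`.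
Bookkeeping: `k = |a \ b|`, `b₁(a ∩ b) = b₁(a) + s`, `b₁(b) = b₁(a ∪ b) + t` with `t ≤ s ≤ k`
("adding an `i`-plaquette can only reduce `b_{i-1}` by one or leave it unchanged"), and the reduced
inequality is `q₁^k q₂^t ≤ q₁^s q₂^k`. [cite: DuncanSchweinhart2025, Lemma 32 (proof)] -/
theorem weight_mul_weight_le_of_hatParam_eq {p₁ p₂ q₁ q₂ : ℝ} (hp₁ : p₁ ∈ Set.Ioo (0 : ℝ) 1)
    (hp₂ : p₂ ∈ Set.Ioo (0 : ℝ) 1) (hq₁ : 1 ≤ q₁) (h12 : q₁ ≤ q₂)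
    (hhat : hatParam p₁ q₁ = hatParam p₂ q₂) (a b : Finset (Plaquette d L)) :
    weight F p₁ q₁ a * weight F p₂ q₂ b ≤ weight F p₁ q₁ (a ⊓ b) * weight F p₂ q₂ (a ⊔ b) := by
  classical
  have hq₂ : 1 ≤ q₂ := hq₁.trans h12
  have hq1p : 0 < q₁ := zero_lt_one.trans_le hq₁
  have hq2p : 0 < q₂ := zero_lt_one.trans_le hq₂
  have h1p₁ : 0 < 1 - p₁ := sub_pos.mpr hp₁.2
  have h1p₂ : 0 < 1 - p₂ := sub_pos.mpr hp₂.2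
  -- cardinalities: `k = |a \ b|`
  set k := (a \ b).card with hk
  have hca : a.card = (a ∩ b).card + k := by
    have := Finset.card_sdiff_add_card_inter a b
    omega
  have hcu : (a ∪ b).card = b.card + k := by
    rw [hk, ← Finset.card_union_of_disjoint (Finset.disjoint_sdiff (s := b) (t := a)),
      Finset.union_sdiff_self_eq_union, Finset.union_comm]
  have hcac : (a ∩ b)ᶜ.card = aᶜ.card + k := by
    have := Finset.card_compl (a ∩ b); have := Finset.card_compl a
    have : (a ∩ b).card ≤ a.card := Finset.card_le_card Finset.inter_subset_left
    have : a.card ≤ Fintype.card (Plaquette d L) := Finset.card_le_univ a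
    omega
  have hcbc : bᶜ.card = (a ∪ b)ᶜ.card + k := by
    have := Finset.card_compl (a ∪ b); have := Finset.card_compl b
    have : (a ∪ b).card ≤ Fintype.card (Plaquette d L) := Finset.card_le_univ _
    omega
  -- Betti numbers: `t ≤ s ≤ k`
  have hsa : bettiOne F a ≤ bettiOne F (a ∩ b) := bettiOne_mono F Finset.inter_subset_left
  have htb : bettiOne F (a ∪ b) ≤ bettiOne F b := bettiOne_mono F Finset.subset_union_right
  have hmv := bettiOne_union_add_inter F a b
  have hk' : bettiOne F (a ∩ b) ≤ bettiOne F a + k := by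
    have e : a ∩ b ∪ a \ b = a := by
      ext x; simp only [Finset.mem_union, Finset.mem_inter, Finset.mem_sdiff]; tauto
    have := bettiOne_le_bettiOne_union_add_card F (a ∩ b) (a \ b)
    rwa [e] at this
  obtain ⟨s, hs⟩ := Nat.exists_eq_add_of_le hsa
  obtain ⟨t, ht⟩ := Nat.exists_eq_add_of_le htb
  have hts : t ≤ s := by omega
  have hsk : s ≤ k := by omega
  -- the fixed-`p̂` relation and the reduced numeric inequality
  have key : p₁ * (1 - p₂) * q₂ = p₂ * (1 - p₁) * q₁ :=
    (hatParam_eq_hatParam_iff hp₁ hp₂ hq1p hq2p).mp hhat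
  have keyk : (p₁ * (1 - p₂)) ^ k * q₂ ^ k = (p₂ * (1 - p₁)) ^ k * q₁ ^ k := by
    rw [← mul_pow, ← mul_pow, key]
  have hnum : q₁ ^ k * q₂ ^ t ≤ q₁ ^ s * q₂ ^ k := by
    obtain ⟨m, hm⟩ := Nat.exists_eq_add_of_le hsk
    rw [hm, pow_add, pow_add]
    have e1 : q₁ ^ m ≤ q₂ ^ m := pow_le_pow_left₀ hq1p.le h12 m
    have e2 : q₂ ^ t ≤ q₂ ^ s := pow_le_pow_right₀ hq₂ hts
    calc q₁ ^ s * q₁ ^ m * q₂ ^ t ≤ q₁ ^ s * q₂ ^ m * q₂ ^ s :=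
          mul_le_mul (mul_le_mul_of_nonneg_left e1 (pow_nonneg hq1p.le _)) e2 (pow_nonneg hq2p.le _)
            (mul_nonneg (pow_nonneg hq1p.le _) (pow_nonneg hq2p.le _))
      _ = q₁ ^ s * (q₂ ^ s * q₂ ^ m) := by ring
  have core : (p₁ * (1 - p₂)) ^ k * (q₁ ^ bettiOne F a * q₂ ^ (bettiOne F (a ∪ b) + t)) ≤
      (p₂ * (1 - p₁)) ^ k * (q₁ ^ (bettiOne F a + s) * q₂ ^ bettiOne F (a ∪ b)) := by
    refine le_of_mul_le_mul_right ?_ (pow_pos hq2p k)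
    have hN : 0 ≤ (p₂ * (1 - p₁)) ^ k * (q₁ ^ bettiOne F a * q₂ ^ bettiOne F (a ∪ b)) :=
      mul_nonneg (pow_nonneg (mul_nonneg hp₂.1.le h1p₁.le) _)
        (mul_nonneg (pow_nonneg hq1p.le _) (pow_nonneg hq2p.le _))
    calc (p₁ * (1 - p₂)) ^ k * (q₁ ^ bettiOne F a * q₂ ^ (bettiOne F (a ∪ b) + t)) * q₂ ^ k
        = (p₁ * (1 - p₂)) ^ k * q₂ ^ k * (q₁ ^ bettiOne F a * q₂ ^ bettiOne F (a ∪ b)) *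
            q₂ ^ t := by rw [pow_add]; ring
      _ = (p₂ * (1 - p₁)) ^ k * (q₁ ^ bettiOne F a * q₂ ^ bettiOne F (a ∪ b)) *
            (q₁ ^ k * q₂ ^ t) := by rw [keyk]; ring
      _ ≤ (p₂ * (1 - p₁)) ^ k * (q₁ ^ bettiOne F a * q₂ ^ bettiOne F (a ∪ b)) *
            (q₁ ^ s * q₂ ^ k) := mul_le_mul_of_nonneg_left hnum hN
      _ = (p₂ * (1 - p₁)) ^ k * (q₁ ^ (bettiOne F a + s) * q₂ ^ bettiOne F (a ∪ b)) * q₂ ^ k := by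
            rw [pow_add]; ring
  -- assemble
  have hC : 0 ≤ p₁ ^ (a ∩ b).card * (1 - p₁) ^ aᶜ.card * p₂ ^ b.card * (1 - p₂) ^ (a ∪ b)ᶜ.card :=
    mul_nonneg (mul_nonneg (mul_nonneg (pow_nonneg hp₁.1.le _) (pow_nonneg h1p₁.le _))
      (pow_nonneg hp₂.1.le _)) (pow_nonneg h1p₂.le _)
  unfold weight
  simp only [Finset.inf_eq_inter, Finset.sup_eq_union]
  rw [hca, hcu, hcac, hcbc, hs, ht]
  calc p₁ ^ ((a ∩ b).card + k) * (1 - p₁) ^ aᶜ.card * q₁ ^ bettiOne F a *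
        (p₂ ^ b.card * (1 - p₂) ^ ((a ∪ b)ᶜ.card + k) * q₂ ^ (bettiOne F (a ∪ b) + t))
      = p₁ ^ (a ∩ b).card * (1 - p₁) ^ aᶜ.card * p₂ ^ b.card * (1 - p₂) ^ (a ∪ b)ᶜ.card *
          ((p₁ * (1 - p₂)) ^ k * (q₁ ^ bettiOne F a * q₂ ^ (bettiOne F (a ∪ b) + t))) := by
        rw [pow_add, pow_add, mul_pow]; ring
    _ ≤ p₁ ^ (a ∩ b).card * (1 - p₁) ^ aᶜ.card * p₂ ^ b.card * (1 - p₂) ^ (a ∪ b)ᶜ.card *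
          ((p₂ * (1 - p₁)) ^ k * (q₁ ^ (bettiOne F a + s) * q₂ ^ bettiOne F (a ∪ b))) :=
        mul_le_mul_of_nonneg_left core hC
    _ = p₁ ^ (a ∩ b).card * (1 - p₁) ^ (aᶜ.card + k) * q₁ ^ (bettiOne F a + s) *
          (p₂ ^ (b.card + k) * (1 - p₂) ^ (a ∪ b)ᶜ.card * q₂ ^ bettiOne F (a ∪ b)) := by
        rw [pow_add, pow_add, mul_pow]; ring

/-- **Lemma 32, second half, PROVED: at fixed `p̂ = (p/q)/(1 - p + p/q)`, `μ_{X,p,q}` is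
stochastically increasing in `q ≥ 1`** — for `p₁, p₂ ∈ (0,1)`, `1 ≤ q₁ ≤ q₂` with
`p̂(p₁,q₁) = p̂(p₂,q₂)` and every increasing non-negative `h`, `μ_{X,p₁,q₁}(h) ≤ μ_{X,p₂,q₂}(h)`
(typed for `i = 2` on the torus). By Holley's inequality. [cite: DuncanSchweinhart2025, Lemma 32] -/
theorem expect_le_expect_of_hatParam_eq {p₁ p₂ q₁ q₂ : ℝ} (hp₁ : p₁ ∈ Set.Ioo (0 : ℝ) 1)
    (hp₂ : p₂ ∈ Set.Ioo (0 : ℝ) 1) (hq₁ : 1 ≤ q₁) (h12 : q₁ ≤ q₂)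
    (hhat : hatParam p₁ q₁ = hatParam p₂ q₂) {h : Finset (Plaquette d L) → ℝ} (hh₀ : 0 ≤ h)
    (hh : Monotone h) : expect F p₁ q₁ h ≤ expect F p₂ q₂ h := by
  classical
  have hp₁' : p₁ ∈ Set.Icc (0 : ℝ) 1 := ⟨hp₁.1.le, hp₁.2.le⟩
  have hp₂' : p₂ ∈ Set.Icc (0 : ℝ) 1 := ⟨hp₂.1.le, hp₂.2.le⟩
  have hq1p : 0 < q₁ := zero_lt_one.trans_le hq₁
  have hq2p : 0 < q₂ := hq1p.trans_le h12
  have hZ1 := partitionFn_pos (d := d) (L := L) F hp₁ hq1p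
  have hZ2 := partitionFn_pos (d := d) (L := L) F hp₂ hq2p
  unfold expect
  have e1 : ∀ ω, prob F p₁ q₁ ω * h ω = h ω * prob F p₁ q₁ ω := fun ω => mul_comm _ _
  have e2 : ∀ ω, prob F p₂ q₂ ω * h ω = h ω * prob F p₂ q₂ ω := fun ω => mul_comm _ _
  simp_rw [e1, e2]
  refine holley (prob (d := d) (L := L) F p₁ q₁) (prob (d := d) (L := L) F p₂ q₂) h hh₀
    (fun ω => div_nonneg (weight_nonneg F hp₁' hq1p.le ω) hZ1.le)
    (fun ω => div_nonneg (weight_nonneg F hp₂' hq2p.le ω) hZ2.le)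
    hh ?_ ?_
  · rw [sum_prob_eq_one F hp₁ hq1p, sum_prob_eq_one F hp₂ hq2p]
  · intro a b
    unfold prob
    rw [div_mul_div_comm, div_mul_div_comm]
    exact div_le_div_of_nonneg_right
      (weight_mul_weight_le_of_hatParam_eq F hp₁ hp₂ hq₁ h12 hhat a b) (mul_nonneg hZ1.le hZ2.le)

/-- At fixed `p̂` a larger `q` needs a larger `p`: if `p̂(p₁,q₁) = p̂(p₂,q₂)` with `0 < q₁ ≤ q₂`
then `p₁ ≤ p₂`. [cite: DuncanSchweinhart2025, Lemma 32 (proof: "`p̂` is decreasing in `q`")] -/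
theorem le_of_hatParam_eq {p₁ p₂ q₁ q₂ : ℝ} (hp₁ : p₁ ∈ Set.Ioo (0 : ℝ) 1)
    (hp₂ : p₂ ∈ Set.Ioo (0 : ℝ) 1) (hq₁ : 0 < q₁) (h12 : q₁ ≤ q₂)
    (hhat : hatParam p₁ q₁ = hatParam p₂ q₂) : p₁ ≤ p₂ := by
  have key := (hatParam_eq_hatParam_iff hp₁ hp₂ hq₁ (hq₁.trans_le h12)).mp hhat
  refine le_of_not_gt fun hlt => ?_
  have h1 : p₂ * (1 - p₁) < p₁ * (1 - p₂) := by nlinarith [hp₁.2, hp₂.1]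
  have h2 : p₂ * (1 - p₁) * q₁ ≤ p₂ * (1 - p₁) * q₂ :=
    mul_le_mul_of_nonneg_left h12 (mul_nonneg hp₂.1.le (sub_nonneg.mpr hp₁.2.le))
  have h3 : p₂ * (1 - p₁) * q₂ < p₁ * (1 - p₂) * q₂ := mul_lt_mul_of_pos_right h1 (hq₁.trans_le h12)
  linarith

end QMonotone

end PlaquetteRC

end Literature.MathematicalPhysics.QuantumFieldTheory
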